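import Summits.Ventures.PercRepro.S1TriangleVCount
import Summits.Ventures.PercRepro.S1FiveCircuitX3B
import Summits.Ventures.PercRepro.S1CellCaps5

/-!
# PercRepro — the cells `(7, 34)`, `(7, 35)`, `(8, 20)` of the `q = 4` window, by LEMMAS V, W′ and X⁺⁺ on a grid
(p2, gen 18)

LEMMA X⁺⁺ (`S1FiveCircuitX3`) bounds the five-circuits by `s₅ ≤ ⌊(24·C(n,4) − (6·C(n−3,2) + 16(n−3))·s₃ −
(4n−8)·s₄)/20⌋` for the ACTUAL `s₃` and `s₄`; with LEMMA V's `s₃ ≤ ⌊n²/9⌋`, LEMMA W′'s `s₄ ≤ ⌊(n(n−1)(n−2) −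
2n·s₃)/8⌋` and the chain's `s₄ ≤ fourCircuitBound d`, the three-cap cell inequality is certified on a GRID of blocks
`[j·Δ₃, (j+1)·Δ₃) × [k·Δ₄, (k+1)·Δ₄)` in `(s₃, s₄)`: the cell at `P = (j+1)Δ₃ − 1`, `S = min(fcb, W′(jΔ₃), (k+1)Δ₄)`,
`S5 = X⁺⁺(jΔ₃, kΔ₄)` dominates its block (every cap is monotone the right way), and only the blocks that meet
`s₄ ≤ min(fcb, W′(jΔ₃))` are needed. `(7, 34)`: `Δ = (10, 500)`, `277` cells, twin worst `0.9790`; `(7, 35)`: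
`Δ = (20, 1000)`, `81` cells, `0.9422`; `(8, 20)`: `Δ = (4, 100)`, `478` cells, `0.9777`. So the `e`-free cores of
rank `7` with `41` / `42` points and of rank `8` with `28` points satisfy `RLS` at level `4`: the rows `p = 7` and
`p = 8` now end at `(7, 33)` and `(8, 19)`.

* `cell_seven_thirtyfour_grid`, `cell_seven_thirtyfive_grid`, `cell_eight_twenty_grid` — the kernel grids;
* **`c025_core_seven_thirtyfour`**, **`c025_core_seven_thirtyfive`**, **`c025_core_eight_twenty`** — the cores.
Axioms: standard.
-/

open scoped Matroid

namespace PercRepro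

namespace S1

open Set

variable {α : Type}

/-- The grid of `(7, 34)`: `Δ₃ = 10`, `Δ₄ = 500`; `s₃ ≤ 186`, `s₄ ≤ min(10557, W′)`. -/
theorem cell_seven_thirtyfour_grid : ∀ j < 19, ∀ k < 22,
    k * 500 ≤ min 10557 ((63960 - 82 * (j * 10)) / 8) →
    cellOK14 7 34 (min 186 ((j + 1) * 10 - 1)) (min (min 10557 ((63960 - 82 * (j * 10)) / 8)) ((k + 1) * 500))
      ((2430480 - 4826 * (j * 10) - 156 * (k * 500)) / 20) = true := by
  decide +kernel

/-- The grid of `(7, 35)`: `Δ₃ = 20`, `Δ₄ = 1000`; `s₃ ≤ 196`, `s₄ ≤ min(11493, W′)`. -/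
theorem cell_seven_thirtyfive_grid : ∀ j < 10, ∀ k < 12,
    k * 1000 ≤ min 11493 ((68880 - 84 * (j * 20)) / 8) →
    cellOK14 7 35 (min 196 ((j + 1) * 20 - 1)) (min (min 11493 ((68880 - 84 * (j * 20)) / 8)) ((k + 1) * 1000))
      ((2686320 - 5070 * (j * 20) - 160 * (k * 1000)) / 20) = true := by
  decide +kernel

/-- The grid of `(8, 20)`: `Δ₃ = 4`, `Δ₄ = 100`; `s₃ ≤ 87`, `s₄ ≤ min(2255, W′)`. -/
theorem cell_eight_twenty_grid : ∀ j < 22, ∀ k < 23,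
    k * 100 ≤ min 2255 ((19656 - 56 * (j * 4)) / 8) →
    cellOK14 8 20 (min 87 ((j + 1) * 4 - 1)) (min (min 2255 ((19656 - 56 * (j * 4)) / 8)) ((k + 1) * 100))
      ((491400 - 2200 * (j * 4) - 104 * (k * 100)) / 20) = true := by
  decide +kernel

/-- **THE CELL `(7, 34)`**: an `e`-free core of rank `7` with `41` points satisfies `RLS` at level `4`. -/
theorem c025_core_seven_thirtyfour (M : Matroid α) [M.Finite] (hR : M.eRank = (7 : ℕ)) (hn : M.E.ncard = 41)
    (hfree : ∀ e ∈ M.E, ∃ A ⊆ M.E \ {e}, e ∉ M.closure A ∧ e ∉ M.closure ((M.E \ {e}) \ A)) :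
    ThmN.RLS M 7 4 := by
  have hd : M.E.encard = M.eRank + ((34 : ℕ) : ℕ∞) := by
    rw [hR, ← M.ground_finite.cast_ncard_eq, hn]
    push_cast
    ring
  set s3 := {C : Set α | M.IsCircuit C ∧ C.ncard = 3}.ncard with hs3
  set s4 := {C : Set α | M.IsCircuit C ∧ C.ncard = 4}.ncard with hs4
  have hV : s3 ≤ 186 := by
    have h := core_ncard_triangles_le_sq_div_nine M hfree
    rw [hn] at h
    exact h.trans (by norm_num)
  have hfcb : s4 ≤ 10557 := by
    have h := ncard_fourCircuits_le_fourCircuitBound M hfree hd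
    rwa [show fourCircuitBound 34 = 10557 by decide] at h
  have hW := core_eight_mul_ncard_fourCircuits_add_le M hfree
  rw [hn] at hW
  have hX := core_twenty_mul_ncard_fiveCircuits_add_add_le M hfree
  rw [hn, show Nat.choose (41 - 3) 2 = 703 by decide, show Nat.choose 41 4 = 101270 by decide] at hX
  have hj := Nat.lt_mul_div_succ s3 (by norm_num : 0 < 10)
  have hj' := Nat.div_mul_le_self s3 10
  have hk := Nat.lt_mul_div_succ s4 (by norm_num : 0 < 500)
  have hk' := Nat.div_mul_le_self s4 500
  have hP : s3 ≤ min 186 ((s3 / 10 + 1) * 10 - 1) := le_min hV (by omega)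
  have hS : s4 ≤ min (min 10557 ((63960 - 82 * (s3 / 10 * 10)) / 8)) ((s4 / 500 + 1) * 500) := by
    refine le_min (le_min hfcb ?_) (by omega)
    rw [Nat.le_div_iff_mul_le (by norm_num)]
    omega
  have hS5 : {C : Set α | M.IsCircuit C ∧ C.ncard = 5}.ncard ≤
      (2430480 - 4826 * (s3 / 10 * 10) - 156 * (s4 / 500 * 500)) / 20 := by
    rw [Nat.le_div_iff_mul_le (by norm_num)]
    omega
  exact rls_of_cellOK14 M 7 34 _ _ _ (by norm_num) hR hn hfree hP hS hS5 (by norm_num)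
    (cell_seven_thirtyfour_grid _ (by omega) _ (by omega) (by
      have : s4 / 500 * 500 ≤ s4 := hk'
      exact le_trans this (le_trans (le_min hfcb (by rw [Nat.le_div_iff_mul_le (by norm_num)]; omega)) le_rfl)))

/-- **THE CELL `(7, 35)`**: an `e`-free core of rank `7` with `42` points satisfies `RLS` at level `4`. -/
theorem c025_core_seven_thirtyfive (M : Matroid α) [M.Finite] (hR : M.eRank = (7 : ℕ)) (hn : M.E.ncard = 42)
    (hfree : ∀ e ∈ M.E, ∃ A ⊆ M.E \ {e}, e ∉ M.closure A ∧ e ∉ M.closure ((M.E \ {e}) \ A)) :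
    ThmN.RLS M 7 4 := by
  have hd : M.E.encard = M.eRank + ((35 : ℕ) : ℕ∞) := by
    rw [hR, ← M.ground_finite.cast_ncard_eq, hn]
    push_cast
    ring
  set s3 := {C : Set α | M.IsCircuit C ∧ C.ncard = 3}.ncard with hs3
  set s4 := {C : Set α | M.IsCircuit C ∧ C.ncard = 4}.ncard with hs4
  have hV : s3 ≤ 196 := by
    have h := core_ncard_triangles_le_sq_div_nine M hfree
    rw [hn] at h
    exact h.trans (by norm_num)
  have hfcb : s4 ≤ 11493 := by
    have h := ncard_fourCircuits_le_fourCircuitBound M hfree hd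
    rwa [show fourCircuitBound 35 = 11493 by decide] at h
  have hW := core_eight_mul_ncard_fourCircuits_add_le M hfree
  rw [hn] at hW
  have hX := core_twenty_mul_ncard_fiveCircuits_add_add_le M hfree
  rw [hn, show Nat.choose (42 - 3) 2 = 741 by decide, show Nat.choose 42 4 = 111930 by decide] at hX
  have hj := Nat.lt_mul_div_succ s3 (by norm_num : 0 < 20)
  have hj' := Nat.div_mul_le_self s3 20
  have hk := Nat.lt_mul_div_succ s4 (by norm_num : 0 < 1000)
  have hk' := Nat.div_mul_le_self s4 1000
  have hP : s3 ≤ min 196 ((s3 / 20 + 1) * 20 - 1) := le_min hV (by omega)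
  have hS : s4 ≤ min (min 11493 ((68880 - 84 * (s3 / 20 * 20)) / 8)) ((s4 / 1000 + 1) * 1000) := by
    refine le_min (le_min hfcb ?_) (by omega)
    rw [Nat.le_div_iff_mul_le (by norm_num)]
    omega
  have hS5 : {C : Set α | M.IsCircuit C ∧ C.ncard = 5}.ncard ≤
      (2686320 - 5070 * (s3 / 20 * 20) - 160 * (s4 / 1000 * 1000)) / 20 := by
    rw [Nat.le_div_iff_mul_le (by norm_num)]
    omega
  exact rls_of_cellOK14 M 7 35 _ _ _ (by norm_num) hR hn hfree hP hS hS5 (by norm_num)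
    (cell_seven_thirtyfive_grid _ (by omega) _ (by omega) (by
      have : s4 / 1000 * 1000 ≤ s4 := hk'
      exact le_trans this (le_min hfcb (by rw [Nat.le_div_iff_mul_le (by norm_num)]; omega))))

/-- **THE CELL `(8, 20)`**: an `e`-free core of rank `8` with `28` points satisfies `RLS` at level `4`. -/
theorem c025_core_eight_twenty (M : Matroid α) [M.Finite] (hR : M.eRank = (8 : ℕ)) (hn : M.E.ncard = 28)
    (hfree : ∀ e ∈ M.E, ∃ A ⊆ M.E \ {e}, e ∉ M.closure A ∧ e ∉ M.closure ((M.E \ {e}) \ A)) :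
    ThmN.RLS M 8 4 := by
  have hd : M.E.encard = M.eRank + ((20 : ℕ) : ℕ∞) := by
    rw [hR, ← M.ground_finite.cast_ncard_eq, hn]
    push_cast
    ring
  set s3 := {C : Set α | M.IsCircuit C ∧ C.ncard = 3}.ncard with hs3
  set s4 := {C : Set α | M.IsCircuit C ∧ C.ncard = 4}.ncard with hs4
  have hV : s3 ≤ 87 := by
    have h := core_ncard_triangles_le_sq_div_nine M hfree
    rw [hn] at h
    exact h.trans (by norm_num)
  have hfcb : s4 ≤ 2255 := by
    have h := ncard_fourCircuits_le_fourCircuitBound M hfree hd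
    rwa [show fourCircuitBound 20 = 2255 by decide] at h
  have hW := core_eight_mul_ncard_fourCircuits_add_le M hfree
  rw [hn] at hW
  have hX := core_twenty_mul_ncard_fiveCircuits_add_add_le M hfree
  rw [hn, show Nat.choose (28 - 3) 2 = 300 by decide, show Nat.choose 28 4 = 20475 by decide] at hX
  have hj := Nat.lt_mul_div_succ s3 (by norm_num : 0 < 4)
  have hj' := Nat.div_mul_le_self s3 4
  have hk := Nat.lt_mul_div_succ s4 (by norm_num : 0 < 100)
  have hk' := Nat.div_mul_le_self s4 100
  have hP : s3 ≤ min 87 ((s3 / 4 + 1) * 4 - 1) := le_min hV (by omega)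
  have hS : s4 ≤ min (min 2255 ((19656 - 56 * (s3 / 4 * 4)) / 8)) ((s4 / 100 + 1) * 100) := by
    refine le_min (le_min hfcb ?_) (by omega)
    rw [Nat.le_div_iff_mul_le (by norm_num)]
    omega
  have hS5 : {C : Set α | M.IsCircuit C ∧ C.ncard = 5}.ncard ≤
      (491400 - 2200 * (s3 / 4 * 4) - 104 * (s4 / 100 * 100)) / 20 := by
    rw [Nat.le_div_iff_mul_le (by norm_num)]
    omega
  exact rls_of_cellOK14 M 8 20 _ _ _ (by norm_num) hR hn hfree hP hS hS5 (by norm_num)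
    (cell_eight_twenty_grid _ (by omega) _ (by omega) (by
      have : s4 / 100 * 100 ≤ s4 := hk'
      exact le_trans this (le_min hfcb (by rw [Nat.le_div_iff_mul_le (by norm_num)]; omega))))

end S1

end PercRepro
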